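import Summits.BirchSwinnertonDyer.Rank1Residual.X11b.BDPFrameUniquenessInt
import HarnessLib

/-!
# X11b — the MAHLER BOUND for values of an element of `𝓞_{ℂ_p}⟦T⟧` along the powers of a principal
# unit: `‖Σ_j c_j · Q(x^j − 1)‖ ≤ sup_k ‖P(x^k)‖` for every polynomial `P = Σ_j c_j X^j`

HONEST FRAMING (cell `b2b-bsdres`, run/shared/lean/b2b/bsd-rank1-residual/, verbatim in every
file): the goal of the cell is to DELETE the COMBINATION-SHAPED residual classes of the
Birch–Swinnerton-Dyer formula for ALL analytic-rank `≤ 1` elliptic curves over `ℚ` — "full BSD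
formula for every rank `≤ 1` curve in class `C`" assembled STRICTLY from published theorems — so
that the rank-`≤ 1` remainder becomes exactly the CONSTRUCTION-SHAPED classes, which are TYPED
(missing-input `Prop`s), NOT attempted. This is not "finishing BSD". Sub-cell
`b2b-bsdres-multr1-p1` (X11b, route R1, gen 25); THEOREMS ONLY (elementary `p`-adic analysis; no
definition, no named fact, no `sorry`); valid at every prime `p`; nothing here changes a label.

## Why this file (step I of IDEAL RIGIDITY ACROSS PERIODS, INTENT HOME/INBOX.md 2026-08-21)

Two BDP frames `L, L'` of the same `(ι, 𝔭, κ, γ, f)` with different periods take, at the avatar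
points `x^j − 1` of the powers `φ₀^j` of one interpolation character, values tied by `L'(x^j − 1) =
b^j · L(x^j − 1)`. To compare the IDEALS `(L)`, `(L')` one tests both against polynomials in the
point: for `P = Σ_j c_j X^j` the functional `Λ_Q(P) := Σ_j c_j · Q(x^j − 1)` satisfies
`Λ_{L'}(P) = Λ_L(P(bX))`, and — this file — it is BOUNDED BY THE VALUES OF `P` ON THE POINTS `x^k`:

* **`R1.norm_sum_mul_value_le`**: for `Q ∈ 𝓞_{ℂ_p}⟦T⟧`, `x ∈ ℂ_p` with `‖x − 1‖ < 1`, values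
  `Q(x^j − 1) = V_j` (`IntSeries.HasValueAt`), a finitely supported coefficient vector `c` on
  `range d`, and a bound `‖Σ_{j<d} c_j (x^k)^j‖ ≤ B` for ALL `k : ℕ`: `‖Σ_{j<d} c_j V_j‖ ≤ B`.
  Proof (Mahler): `Σ_j c_j V_j = Σ'_n q_n · Σ_j c_j (x^j − 1)^n` and
  `Σ_j c_j (x^j − 1)^n = Σ_{i ≤ n} (−1)^{n−i} C(n,i) · Σ_j c_j (x^i)^j` is an `n`-th finite difference
  of the sequence `k ↦ P(x^k)`, of norm `≤ B`; `‖q_n‖ ≤ 1`; ultrametric `tsum` bound.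
* `R1.sum_mul_sub_one_pow_eq` — the finite-difference identity; `R1.hasSum_sum_mul_value` — the
  rearranged series.

References: [Washington1997] §5.1 (principal units); [Cassels1986] Ch. 12 (Mahler expansions) —
only the finite-difference identity is used, in elementary form.
-/

noncomputable section

open scoped Classical Topology
open Filter PowerSeries Finset
open Literature.NumberTheory.EllipticCurves

namespace Summit.BirchSwinnertonDyer.Rank1Residual.X11b

variable {p : ℕ} [Fact p.Prime]

/-! ### §1 The finite-difference identity -/

/-- **Finite-difference identity**: `Σ_{j<d} c_j (x^j − 1)^n = Σ_{i ≤ n} (x-free binomial weights) ·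
Σ_{j<d} c_j (x^i)^j`, precisely
`Σ_{j<d} c_j (x^j − 1)^n = Σ_{i ∈ range (n+1)} ((−1)^{n−i} · C(n,i)) · Σ_{j<d} c_j (x^i)^j`.
[folklore] -/
theorem R1.sum_mul_sub_one_pow_eq (c : ℕ → ℂ_[p]) (d : ℕ) (x : ℂ_[p]) (n : ℕ) :
    ∑ j ∈ range d, c j * (x ^ j - 1) ^ n =
      ∑ i ∈ range (n + 1), ((-1 : ℂ_[p]) ^ (n - i) * (n.choose i : ℂ_[p])) *
        ∑ j ∈ range d, c j * (x ^ i) ^ j := by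
  have hexp : ∀ j : ℕ, (x ^ j - 1) ^ n =
      ∑ i ∈ range (n + 1), (x ^ i) ^ j * ((-1 : ℂ_[p]) ^ (n - i) * (n.choose i : ℂ_[p])) := by
    intro j
    rw [sub_eq_add_neg, add_pow]
    refine sum_congr rfl fun i _ => ?_
    rw [← pow_mul, mul_comm j i, pow_mul]
    ring
  simp_rw [hexp, mul_sum]
  rw [sum_comm]
  refine sum_congr rfl fun i _ => ?_
  refine sum_congr rfl fun j _ => ?_
  ring

/-- Norm of the binomial weight `(−1)^{n−i} C(n,i)` in `ℂ_p` is `≤ 1`. [folklore] -/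
theorem R1.norm_neg_one_pow_mul_choose_le (n i : ℕ) :
    ‖((-1 : ℂ_[p]) ^ (n - i) * (n.choose i : ℂ_[p]))‖ ≤ 1 := by
  rw [norm_mul, norm_pow, norm_neg, norm_one, one_pow, one_mul, ← Int.cast_natCast,
    ← map_intCast (algebraMap ℚ_[p] ℂ_[p]), norm_algebraMap']
  exact Padic.norm_int_le_one _

/-! ### §2 The rearranged series and the Mahler bound -/

/-- **The rearranged series**: if `Q(x^j − 1) = V_j` for `j < d` then
`Σ_{j<d} c_j V_j = Σ'_n q_n · Σ_{j<d} c_j (x^j − 1)^n` as a `HasSum` (finite sum of convergent series).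
[folklore] -/
theorem R1.hasSum_sum_mul_value {Q : PowerSeries 𝓞_ℂ_[p]} {x : ℂ_[p]} {V : ℕ → ℂ_[p]}
    (c : ℕ → ℂ_[p]) (d : ℕ) (hV : ∀ j, j < d → IntSeries.HasValueAt Q (x ^ j - 1) (V j)) :
    HasSum (fun n ↦ ((coeff n Q : 𝓞_ℂ_[p]) : ℂ_[p]) * ∑ j ∈ range d, c j * (x ^ j - 1) ^ n)
      (∑ j ∈ range d, c j * V j) := by
  have h : ∀ j ∈ range d, HasSum (fun n ↦ c j * (((coeff n Q : 𝓞_ℂ_[p]) : ℂ_[p]) * (x ^ j - 1) ^ n))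
      (c j * V j) := fun j hj => (hV j (mem_range.mp hj)).mul_left (c j)
  have hs := hasSum_sum h
  refine hs.congr_fun fun n => ?_
  rw [mul_sum]
  refine sum_congr rfl fun j _ => ?_
  ring

/-- **MAHLER BOUND.** Let `Q ∈ 𝓞_{ℂ_p}⟦T⟧`, `x ∈ ℂ_p` with `‖x − 1‖ < 1`, and values
`Q(x^j − 1) = V_j` for `j < d`. If the "polynomial" `k ↦ Σ_{j<d} c_j (x^k)^j` is bounded by `B` at
EVERY `k : ℕ`, then `‖Σ_{j<d} c_j V_j‖ ≤ B`: the value functional along the powers of `x` is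
dominated by the sup of the test polynomial on those powers. (Each term of the rearranged series is
`q_n` times an `n`-th finite difference of `k ↦ P(x^k)`, `‖q_n‖ ≤ 1`; ultrametric bound on the sum.)
[cite: Washington1997, §5.1] -/
theorem R1.norm_sum_mul_value_le {Q : PowerSeries 𝓞_ℂ_[p]} {x : ℂ_[p]} {V : ℕ → ℂ_[p]}
    (c : ℕ → ℂ_[p]) (d : ℕ) (hV : ∀ j, j < d → IntSeries.HasValueAt Q (x ^ j - 1) (V j))
    {B : ℝ} (hB0 : 0 ≤ B) (hB : ∀ k : ℕ, ‖∑ j ∈ range d, c j * (x ^ k) ^ j‖ ≤ B) :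
    ‖∑ j ∈ range d, c j * V j‖ ≤ B := by
  have hs := R1.hasSum_sum_mul_value c d hV
  rw [← hs.tsum_eq]
  refine IsUltrametricDist.norm_tsum_le_of_forall_le_of_nonneg hB0 fun n => ?_
  rw [norm_mul, R1.sum_mul_sub_one_pow_eq c d x n]
  have h1 : ‖((coeff n Q : 𝓞_ℂ_[p]) : ℂ_[p])‖ ≤ 1 := R1.norm_coe_padicComplexInt_le_one p _
  have h2 : ‖∑ i ∈ range (n + 1), ((-1 : ℂ_[p]) ^ (n - i) * (n.choose i : ℂ_[p])) *
      ∑ j ∈ range d, c j * (x ^ i) ^ j‖ ≤ B := by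
    refine IsUltrametricDist.norm_sum_le_of_forall_le_of_nonneg hB0 fun i _ => ?_
    rw [norm_mul]
    calc ‖((-1 : ℂ_[p]) ^ (n - i) * (n.choose i : ℂ_[p]))‖ * ‖∑ j ∈ range d, c j * (x ^ i) ^ j‖
        ≤ 1 * B := mul_le_mul (R1.norm_neg_one_pow_mul_choose_le n i) (hB i) (norm_nonneg _)
          zero_le_one
      _ = B := one_mul B
  calc ‖((coeff n Q : 𝓞_ℂ_[p]) : ℂ_[p])‖ * ‖∑ i ∈ range (n + 1), ((-1 : ℂ_[p]) ^ (n - i) *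
        (n.choose i : ℂ_[p])) * ∑ j ∈ range d, c j * (x ^ i) ^ j‖ ≤ 1 * B :=
        mul_le_mul h1 h2 (norm_nonneg _) zero_le_one
    _ = B := one_mul B

/-- **MAHLER BOUND, transported form** (the twin needed for the second frame): the same with the test
points `b · x^k` — if `Q(x^j − 1) = V_j` and `‖Σ_{j<d} c_j b^j (x^k)^j‖ ≤ B` for all `k`, then
`‖Σ_{j<d} (c_j b^j) V_j‖ ≤ B`. (`R1.norm_sum_mul_value_le` for the coefficients `c_j b^j`.)
[cite: Washington1997, §5.1] -/
theorem R1.norm_sum_mul_pow_mul_value_le {Q : PowerSeries 𝓞_ℂ_[p]} {x : ℂ_[p]} {V : ℕ → ℂ_[p]}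
    (c : ℕ → ℂ_[p]) (b : ℂ_[p]) (d : ℕ)
    (hV : ∀ j, j < d → IntSeries.HasValueAt Q (x ^ j - 1) (V j)) {B : ℝ} (hB0 : 0 ≤ B)
    (hB : ∀ k : ℕ, ‖∑ j ∈ range d, c j * (b * x ^ k) ^ j‖ ≤ B) :
    ‖∑ j ∈ range d, c j * b ^ j * V j‖ ≤ B := by
  have h := R1.norm_sum_mul_value_le (fun j => c j * b ^ j) d hV hB0 (fun k => ?_)
  · simpa only [mul_assoc] using h
  · have : ∑ j ∈ range d, c j * b ^ j * (x ^ k) ^ j = ∑ j ∈ range d, c j * (b * x ^ k) ^ j :=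
      sum_congr rfl fun j _ => by rw [mul_pow, mul_assoc]
    rw [this]
    exact hB k

end Summit.BirchSwinnertonDyer.Rank1Residual.X11b

end
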